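import Mathlib

/-!
# SketchGen8 — `DescentSandwich` (crux idea C6 `descent-below-the-edge-band`;
  crux stmt-QuantumFields-19201 / live twin 19935, STUB 4′ `stub_logComparisonSmallBlocks`)

ONE-STEP DESCENT, abstractly.  `X` = fields one level BELOW the datum (depth 1), `Y` = data, `avg : X → Y`
the block averaging, `μ`, `ν` the product Haar measures.  A transport is characterised ONLY by the
push-forward identity with bounded measurable test functions (`IsRT'` = the shape of the tree's
`Balaban1983to89.IsRT` / `RTOpI.isRT` / `integral_towerDensity_mul` / `integral_resDensity_mul`),
so every conclusion is `ν`-a.e. — exactly the currency of STUB 4′ (`∀ᵐ V ∂fieldMeasure …`).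

* `ae_le_of_isRT'`     : transports are monotone a.e. (test against indicators + `ae_nonneg_of_forall_setIntegral_nonneg`).
* `descentSandwich`    : if the two runs' depth-1 densities `ρa`, `ρb` satisfy `e^{κ-r} ρa ≤ ρb ≤ e^{κ+r} ρa` a.e. ON A GOOD
  SET `G`, and the bad parts `1_{Gᶜ} ρa`, `1_{Gᶜ} ρb` transport to at most a fraction `δ < 1` of the totals a.e.
  (`ConditionalEdgeMass`), then a.e. where both transported densities are positive,
  `|log Tb − log Ta − κ| ≤ r − log (1 − δ)`.

Instantiation recipe (tree names): `Ta = heightDensity F γ _ (histGood … K (K/m))`, `Tb` = the same for run `K+1`, both equal to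
ONE application of `rt … .T` to the depth-1 restricted densities `resDensity F γ K S (K − K/m − 1)` (resp. run `K+1`,
level `K − K/m`) by `towerDensity_succ` + `heightDensity_fieldShift`; `G` = depth-1 fields outside their own edge band
(`CascadeMargin`); `κ = κ₁ − κ₂ + κ₃`, `r = r₁ + r₂ + r₃` from STUB 3′ rows read at depth 1 and the e1 minimiser-Cauchy row.
No `sorry` in this file.
-/

namespace Summit.QuantumFields.YangMills.Cruxes.FluctuationComparisonRegPr.Ideate2Descent

open MeasureTheory Set

variable {X Y : Type*} [MeasurableSpace X] [MeasurableSpace Y]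
variable (μ : Measure X) (ν : Measure Y) (avg : X → Y)

/-- Push-forward identity with bounded measurable test functions (shape of the tree's `IsRT`). -/
def IsRT' (ρ : X → ℝ) (ρ' : Y → ℝ) : Prop :=
  ∀ f : Y → ℝ, Measurable f → (∃ C : ℝ, ∀ y, |f y| ≤ C) →
    ∫ y, ρ' y * f y ∂ν = ∫ x, ρ x * f (avg x) ∂μ

variable {μ ν avg}

theorem isRT'_zero : IsRT' μ ν avg 0 0 := by
  intro f _ _; simp

theorem isRT'_smul {ρ : X → ℝ} {T : Y → ℝ} (h : IsRT' μ ν avg ρ T) (c : ℝ) :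
    IsRT' μ ν avg (fun x => c * ρ x) (fun y => c * T y) := by
  intro f hf hC
  have := h f hf hC
  simp_rw [mul_assoc, integral_const_mul, this]

theorem isRT'_sub {ρ₁ ρ₂ : X → ℝ} {T₁ T₂ : Y → ℝ} (h₁ : IsRT' μ ν avg ρ₁ T₁) (h₂ : IsRT' μ ν avg ρ₂ T₂)
    (havg : Measurable avg)
    (hρ₁ : Integrable ρ₁ μ) (hρ₂ : Integrable ρ₂ μ) (hT₁ : Integrable T₁ ν) (hT₂ : Integrable T₂ ν) :
    IsRT' μ ν avg (fun x => ρ₁ x - ρ₂ x) (fun y => T₁ y - T₂ y) := by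
  intro f hf hC
  obtain ⟨C, hC'⟩ := hC
  have hfb : ∀ᵐ y ∂ν, ‖f y‖ ≤ C := Filter.Eventually.of_forall fun y => by simpa using hC' y
  have hfab : ∀ᵐ x ∂μ, ‖f (avg x)‖ ≤ C := Filter.Eventually.of_forall fun x => by simpa using hC' (avg x)
  have i₁ : Integrable (fun y => T₁ y * f y) ν := hT₁.mul_bdd hf.aestronglyMeasurable hfb
  have i₂ : Integrable (fun y => T₂ y * f y) ν := hT₂.mul_bdd hf.aestronglyMeasurable hfb
  have j₁ : Integrable (fun x => ρ₁ x * f (avg x)) μ :=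
    hρ₁.mul_bdd (hf.comp havg).aestronglyMeasurable hfab
  have j₂ : Integrable (fun x => ρ₂ x * f (avg x)) μ :=
    hρ₂.mul_bdd (hf.comp havg).aestronglyMeasurable hfab
  simp_rw [sub_mul]
  rw [integral_sub i₁ i₂, integral_sub j₁ j₂, h₁ f hf ⟨C, hC'⟩, h₂ f hf ⟨C, hC'⟩]

/-- **Transports are monotone a.e.**: `ρ₁ ≤ ρ₂` μ-a.e. ⇒ `T₁ ≤ T₂` ν-a.e. (test the identity against indicators). -/
theorem ae_le_of_isRT' {ρ₁ ρ₂ : X → ℝ} {T₁ T₂ : Y → ℝ} (h₁ : IsRT' μ ν avg ρ₁ T₁) (h₂ : IsRT' μ ν avg ρ₂ T₂)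
    (havg : Measurable avg)
    (hρ₁ : Integrable ρ₁ μ) (hρ₂ : Integrable ρ₂ μ) (hT₁ : Integrable T₁ ν) (hT₂ : Integrable T₂ ν)
    (hle : ρ₁ ≤ᵐ[μ] ρ₂) : T₁ ≤ᵐ[ν] T₂ := by
  have hsub := isRT'_sub h₂ h₁ havg hρ₂ hρ₁ hT₂ hT₁
  have key : ∀ s, MeasurableSet s → ν s < ⊤ → 0 ≤ ∫ y in s, (fun y => T₂ y - T₁ y) y ∂ν := by
    intro s hs _
    have hind : Measurable (s.indicator fun _ => (1 : ℝ)) := measurable_const.indicator hs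
    have hbd : ∃ C : ℝ, ∀ y, |s.indicator (fun _ => (1 : ℝ)) y| ≤ C :=
      ⟨1, fun y => by by_cases hy : y ∈ s <;> simp [hy]⟩
    have hrw : (∫ y in s, (fun y => T₂ y - T₁ y) y ∂ν) =
        ∫ y, (T₂ y - T₁ y) * s.indicator (fun _ => (1 : ℝ)) y ∂ν := by
      rw [← integral_indicator hs]
      congr 1
      funext y
      by_cases hy : y ∈ s <;> simp [hy]
    rw [hrw, hsub _ hind hbd]
    apply integral_nonneg_of_ae
    filter_upwards [hle] with x hx
    have h0 : 0 ≤ s.indicator (fun _ => (1 : ℝ)) (avg x) := by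
      by_cases hy : avg x ∈ s <;> simp [hy]
    exact mul_nonneg (sub_nonneg.mpr hx) h0
  have := ae_nonneg_of_forall_setIntegral_nonneg (hT₂.sub hT₁) key
  filter_upwards [this] with y hy
  simpa [sub_nonneg] using hy

/-- **DESCENT SANDWICH** (the first lemma of card C6).  Hypotheses, all a.e.: representation with rate on the good set `G`
(`hlow`/`hup`), conditional edge mass `≤ δ` for both runs (`hEa`/`hEb`); conclusion: the transported densities compare with
rate `r − log(1−δ)` wherever both are positive. -/
theorem descentSandwich {ρa ρb : X → ℝ} {Ta Tb Ta' Tb' : Y → ℝ} {G : Set X} {κ r δ : ℝ}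
    (havg : Measurable avg) (hG : MeasurableSet G)
    (hρa : Integrable ρa μ) (hρb : Integrable ρb μ)
    (hTa : Integrable Ta ν) (hTb : Integrable Tb ν) (hTa' : Integrable Ta' ν) (hTb' : Integrable Tb' ν)
    (ha0 : 0 ≤ᵐ[μ] ρa) (hb0 : 0 ≤ᵐ[μ] ρb)
    (hRTa : IsRT' μ ν avg ρa Ta) (hRTb : IsRT' μ ν avg ρb Tb)
    (hRTa' : IsRT' μ ν avg (Gᶜ.indicator ρa) Ta') (hRTb' : IsRT' μ ν avg (Gᶜ.indicator ρb) Tb')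
    (hlow : ∀ᵐ x ∂μ, x ∈ G → Real.exp (κ - r) * ρa x ≤ ρb x)
    (hup : ∀ᵐ x ∂μ, x ∈ G → ρb x ≤ Real.exp (κ + r) * ρa x)
    (hEa : ∀ᵐ y ∂ν, Ta' y ≤ δ * Ta y) (hEb : ∀ᵐ y ∂ν, Tb' y ≤ δ * Tb y) (hδ : δ < 1) :
    ∀ᵐ y ∂ν, 0 < Ta y → 0 < Tb y →
      |Real.log (Tb y) - Real.log (Ta y) - κ| ≤ r - Real.log (1 - δ) := by
  -- good parts Ga = Ta - Ta', Gb = Tb - Tb' transport 1_G ρa, 1_G ρb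
  have hGa_i : Integrable (Gᶜ.indicator ρa) μ := hρa.indicator hG.compl
  have hGb_i : Integrable (Gᶜ.indicator ρb) μ := hρb.indicator hG.compl
  have hRGa : IsRT' μ ν avg (fun x => ρa x - Gᶜ.indicator ρa x) (fun y => Ta y - Ta' y) :=
    isRT'_sub hRTa hRTa' havg hρa hGa_i hTa hTa'
  have hRGb : IsRT' μ ν avg (fun x => ρb x - Gᶜ.indicator ρb x) (fun y => Tb y - Tb' y) :=
    isRT'_sub hRTb hRTb' havg hρb hGb_i hTb hTb'
  have hsplit : ∀ (ρ : X → ℝ) (x : X), ρ x - Gᶜ.indicator ρ x = G.indicator ρ x := by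
    intro ρ x
    have := congrArg (fun f => f x) (Set.indicator_self_add_compl G ρ)
    simp only [Pi.add_apply] at this
    linarith
  -- (i) lower comparison of good parts
  have h1 : (fun y => Real.exp (κ - r) * (Ta y - Ta' y)) ≤ᵐ[ν] (fun y => Tb y - Tb' y) := by
    refine ae_le_of_isRT' (isRT'_smul hRGa (Real.exp (κ - r))) hRGb havg
      ((hρa.sub hGa_i).const_mul _) (hρb.sub hGb_i) ((hTa.sub hTa').const_mul _) (hTb.sub hTb') ?_
    filter_upwards [hlow] with x hx
    show Real.exp (κ - r) * (ρa x - Gᶜ.indicator ρa x) ≤ ρb x - Gᶜ.indicator ρb x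
    rw [hsplit, hsplit]
    by_cases hxG : x ∈ G
    · simpa [Set.indicator_of_mem hxG] using hx hxG
    · simp [Set.indicator_of_notMem hxG]
  -- (ii) upper comparison of good parts
  have h2 : (fun y => Tb y - Tb' y) ≤ᵐ[ν] (fun y => Real.exp (κ + r) * (Ta y - Ta' y)) := by
    refine ae_le_of_isRT' hRGb (isRT'_smul hRGa (Real.exp (κ + r))) havg
      (hρb.sub hGb_i) ((hρa.sub hGa_i).const_mul _) (hTb.sub hTb') ((hTa.sub hTa').const_mul _) ?_
    filter_upwards [hup] with x hx
    show ρb x - Gᶜ.indicator ρb x ≤ Real.exp (κ + r) * (ρa x - Gᶜ.indicator ρa x)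
    rw [hsplit, hsplit]
    by_cases hxG : x ∈ G
    · simpa [Set.indicator_of_mem hxG] using hx hxG
    · simp [Set.indicator_of_notMem hxG]
  -- (iii) bad parts are non-negative a.e.
  have h3a : (0 : Y → ℝ) ≤ᵐ[ν] Ta' := by
    refine ae_le_of_isRT' isRT'_zero hRTa' havg (integrable_zero _ _ _) hGa_i (integrable_zero _ _ _) hTa' ?_
    filter_upwards [ha0] with x hx
    by_cases hxG : x ∈ Gᶜ
    · simpa [Set.indicator_of_mem hxG] using hx
    · simp [Set.indicator_of_notMem hxG]
  have h3b : (0 : Y → ℝ) ≤ᵐ[ν] Tb' := by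
    refine ae_le_of_isRT' isRT'_zero hRTb' havg (integrable_zero _ _ _) hGb_i (integrable_zero _ _ _) hTb' ?_
    filter_upwards [hb0] with x hx
    by_cases hxG : x ∈ Gᶜ
    · simpa [Set.indicator_of_mem hxG] using hx
    · simp [Set.indicator_of_notMem hxG]
  filter_upwards [h1, h2, h3a, h3b, hEa, hEb] with y hy1 hy2 hy3a hy3b hyEa hyEb hTa0 hTb0
  simp only [Pi.zero_apply] at hy3a hy3b
  have h1δ : 0 < 1 - δ := by linarith
  -- Ga ≥ (1-δ) Ta > 0, Ga ≤ Ta ; Gb ≥ (1-δ) Tb > 0, Gb ≤ Tb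
  have hGa_lo : (1 - δ) * Ta y ≤ Ta y - Ta' y := by nlinarith
  have hGb_lo : (1 - δ) * Tb y ≤ Tb y - Tb' y := by nlinarith
  have hGa_hi : Ta y - Ta' y ≤ Ta y := by linarith
  have hGb_hi : Tb y - Tb' y ≤ Tb y := by linarith
  have hexp1 : 0 < Real.exp (κ - r) := Real.exp_pos _
  have hexp2 : 0 < Real.exp (κ + r) := Real.exp_pos _
  -- lower bound: Tb ≥ exp(κ-r) * (1-δ) * Ta
  have hlo : Real.exp (κ - r) * (1 - δ) * Ta y ≤ Tb y := by
    calc Real.exp (κ - r) * (1 - δ) * Ta y = Real.exp (κ - r) * ((1 - δ) * Ta y) := by ring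
      _ ≤ Real.exp (κ - r) * (Ta y - Ta' y) := by exact mul_le_mul_of_nonneg_left hGa_lo hexp1.le
      _ ≤ Tb y - Tb' y := hy1
      _ ≤ Tb y := hGb_hi
  -- upper bound: (1-δ) * Tb ≤ exp(κ+r) * Ta
  have hhi : (1 - δ) * Tb y ≤ Real.exp (κ + r) * Ta y := by
    calc (1 - δ) * Tb y ≤ Tb y - Tb' y := hGb_lo
      _ ≤ Real.exp (κ + r) * (Ta y - Ta' y) := hy2
      _ ≤ Real.exp (κ + r) * Ta y := by exact mul_le_mul_of_nonneg_left hGa_hi hexp2.le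
  -- take logs
  have hlogTa := Real.log_le_log (by positivity : 0 < Real.exp (κ - r) * (1 - δ) * Ta y) hlo
  rw [Real.log_mul (by positivity) hTa0.ne', Real.log_mul hexp1.ne' h1δ.ne', Real.log_exp] at hlogTa
  have hlogTb := Real.log_le_log (by positivity : 0 < (1 - δ) * Tb y) hhi
  rw [Real.log_mul h1δ.ne' hTb0.ne', Real.log_mul hexp2.ne' hTa0.ne', Real.log_exp] at hlogTb
  rw [abs_le]
  constructor <;> linarith

end Summit.QuantumFields.YangMills.Cruxes.FluctuationComparisonRegPr.Ideate2Descent
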